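import Mathlib
import Summits.Ventures.PercRepro2.TypedSepThreeSort

/-!
# The `{a₁, b}`-pocket class (HARRIS-1), I: the gluing and the doubly symmetrised kernel (blind
cell PercRepro2, p3 g8, 2026-08-26; `proofs/P3-HARRIS.md` §2)

The doors are now a ROOT and the mark `b`: `a₁` and `b`.  The o-side holds `o` (side state
`(a₁~o, b~o, a₁~b)` inside the pocket, the type `SepThree.OSt`), the far side holds `a₂, a₃` (side
state `SepThree.BSt`, the connections among `a₁, a₂, a₃, b` inside it).  The glued state `gluedH`
is the raw output of the two-door closure lemmas (`TypedSepThreeClosure.lean`) with the doors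
`a₁, b`; the `S₃ × S₃`-symmetrised kernel `dsymH` is symmetric in either side's copies and is
invariant under sorting them (`dsymH_sort3O`, `dsymH_sort3B`).  Unlike the `{a₃, b}`-pocket,
`dsymH` is NOT pointwise nonnegative (min `−8`): the class is certified in
`TypedPocketA1BCert.lean` by typed-Harris-with-spectator slacks on the pocket side.  Own work;
standard axioms.
-/

namespace Summit.Ventures.PercRepro2

namespace CovForm

namespace PocketA1B

open OneTyped SepThree

/-! ## The gluing with the doors `a₁, b` -/

/-- **The glued state** of a copy from its o-side state `(p₁, p_b, X) = (a₁~o, b~o, a₁~b)` and its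
far-side state `(h₁₂, h₃₂, Y, b₁, b₂, b₃)`: with `D = X ∨ b₁` (`a₁ ~ b`),
`a₂~a₁ = h₁₂ ∨ (D ∧ b₂)`, `a₁~b = D`, `a₂~b = b₂ ∨ (D ∧ h₁₂)`, `a₁~a₃ = Y ∨ (D ∧ b₃)`,
`a₂~a₃ = h₃₂ ∨ (D ∧ ((h₁₂ ∧ b₃) ∨ (b₂ ∧ Y)))`, `a₁~o = p₁ ∨ (D ∧ p_b)`, `b~o = p_b ∨ (D ∧ p₁)`,
`a₂~o = (a₂~a₁ ∧ a₁~o) ∨ (a₂~b ∧ b~o)`. -/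
def gluedH (s : OSt) (t : BSt) : St :=
  let p1 := s.1
  let pb := s.2.1
  let X := s.2.2
  let h12 := t.1
  let h32 := t.2.1
  let Y := t.2.2.1
  let b1 := t.2.2.2.1
  let b2 := t.2.2.2.2.1
  let b3 := t.2.2.2.2.2
  let D := X || b1
  let q := h12 || (D && b2)
  let Hb := b2 || (D && h12)
  let L3 := Y || (D && b3)
  let H3 := h32 || (D && ((h12 && b3) || (b2 && Y)))
  let a1o := p1 || (D && pb)
  let bo := pb || (D && p1)
  (q, a1o, (q && a1o) || (Hb && bo), D, Hb, L3, H3)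

/-- The kernel on glued state triples. -/
def psiH (x y w : OSt) (u v r : BSt) : ℤ := KB (gluedH x u) (gluedH y v) (gluedH w r)

/-- **The doubly symmetrised kernel** (36 terms: the o-states and the far states permuted
independently). -/
def dsymH (x y w : OSt) (u v r : BSt) : ℤ :=
  (psiH x y w u v r + psiH x y w u r v + psiH x y w v u r + psiH x y w v r u + psiH x y w r u v +
      psiH x y w r v u) +
  (psiH x w y u v r + psiH x w y u r v + psiH x w y v u r + psiH x w y v r u + psiH x w y r u v +
      psiH x w y r v u) +
  (psiH y x w u v r + psiH y x w u r v + psiH y x w v u r + psiH y x w v r u + psiH y x w r u v +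
      psiH y x w r v u) +
  (psiH y w x u v r + psiH y w x u r v + psiH y w x v u r + psiH y w x v r u + psiH y w x r u v +
      psiH y w x r v u) +
  (psiH w x y u v r + psiH w x y u r v + psiH w x y v u r + psiH w x y v r u + psiH w x y r u v +
      psiH w x y r v u) +
  (psiH w y x u v r + psiH w y x u r v + psiH w y x v u r + psiH w y x v r u + psiH w y x r u v +
      psiH w y x r v u)

/-- `dsymH` is symmetric in the first two o-states. -/
lemma dsymH_swapO12 (x y w : OSt) (u v r : BSt) : dsymH x y w u v r = dsymH y x w u v r := by
  unfold dsymH; ring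

/-- `dsymH` is symmetric in the last two o-states. -/
lemma dsymH_swapO23 (x y w : OSt) (u v r : BSt) : dsymH x y w u v r = dsymH x w y u v r := by
  unfold dsymH; ring

/-- `dsymH` is symmetric in the first two far states. -/
lemma dsymH_swapB12 (x y w : OSt) (u v r : BSt) : dsymH x y w u v r = dsymH x y w v u r := by
  unfold dsymH; ring

/-- `dsymH` is symmetric in the last two far states. -/
lemma dsymH_swapB23 (x y w : OSt) (u v r : BSt) : dsymH x y w u v r = dsymH x y w u r v := by
  unfold dsymH; ring

/-- `dsymH` is unchanged by sorting the o-states. -/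
lemma dsymH_sort3O (x y w : OSt) (u v r : BSt) :
    dsymH x y w u v r = dsymH (sort3O x y w).1 (sort3O x y w).2.1 (sort3O x y w).2.2 u v r := by
  unfold sort3O
  split_ifs <;> dsimp only <;>
    first
    | rfl
    | exact dsymH_swapO12 x y w u v r
    | exact dsymH_swapO23 x y w u v r
    | exact (dsymH_swapO12 x y w u v r).trans (dsymH_swapO23 y x w u v r)
    | exact (dsymH_swapO23 x y w u v r).trans (dsymH_swapO12 x w y u v r)
    | exact ((dsymH_swapO12 x y w u v r).trans (dsymH_swapO23 y x w u v r)).trans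
        (dsymH_swapO12 y w x u v r)

/-- `dsymH` is unchanged by sorting the far states. -/
lemma dsymH_sort3B (x y w : OSt) (u v r : BSt) :
    dsymH x y w u v r = dsymH x y w (sort3B u v r).1 (sort3B u v r).2.1 (sort3B u v r).2.2 := by
  unfold sort3B
  split_ifs <;> dsimp only <;>
    first
    | rfl
    | exact dsymH_swapB12 x y w u v r
    | exact dsymH_swapB23 x y w u v r
    | exact (dsymH_swapB12 x y w u v r).trans (dsymH_swapB23 x y w v u r)
    | exact (dsymH_swapB23 x y w u v r).trans (dsymH_swapB12 x y w u r v)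
    | exact ((dsymH_swapB12 x y w u v r).trans (dsymH_swapB23 x y w v u r)).trans
        (dsymH_swapB12 x y w v r u)

end PocketA1B

end CovForm

end Summit.Ventures.PercRepro2
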